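import Summits.KontsevichZagierPeriods.KontsevichZagierPeriods.Theorems.TorsionLogsOneThirdPeriod
import HarnessLib

/-!
# `BetaLinearSector` (stmt-KontsevichZagierPeriods-3897), line `fermat-sector-transport` — stub `stub_isogenyThree_piece_neg`

Level `6` of the crux `BetaLinearSector` needs the CM coincidence `B(1/6,1/2) = √3·B(1/3,1/2)`
INSIDE the Kontsevich–Zagier calculus of moves (`KZCalculus.lean`). It is carried by the REAL
`3`-ISOGENY `ψ : E : y² = x³ + 1 → E′ : Y² = X³ − 1`,
`ψ(x, y) = ((x³ + 4)/(3x²), y(x³ − 8)/(3√3·x³))` (Vélu's `3`-isogeny with kernel `{O, (0, ±1)}`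
onto `y² = x³ − 27`, rescaled by `(x, y) ↦ (x/3, y/(3√3))`), for which `ψ^*(dX/Y) = √3·dx/y`.
Its `x`-map `X(x) = (x³ + 4)/(3x²)` is `ℚ`-rational, `X′(x) = (x³ − 8)/(3x³)`, and the polynomial
identity `(x³ + 4)³ − 27x⁶ = (x³ + 1)(x³ − 8)²` reads `X(x)³ − 1 = (x³ + 1)·X′(x)²/3`.

This file is the piece of the `3 : 1` cover `E(ℝ) → E′(ℝ)` over the arc `(−1, 0)`: there `x³ < 0` and
`x³ − 8 < 0`, so `X′ > 0`; `X(−1) = 1` and `X → +∞` at `0⁻`, so `X` maps `(−1, 0)` increasingly onto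
`(1, ∞)`, and the rule-(2) Jacobian identity `(1/√(X³ − 1))·|X′| = √3/√(x³ + 1)` is exact on the
arc. Hence for `S = [(−1,0), √3/√(x³+1)]`, `T = [(1,∞), 1/√(X³−1)]` (integrands pinned on the
domains only) ONE change-of-variables move gives `[S] − [T] ∈ KZ.changeOfVariablesRel`
(`isoNeg_cov`), so `KZ.Equivalent S T` (`stub_isogenyThree_piece_neg`). The file is the template
`TorsionLogs.OneThirdPeriod.arc_cov` (the doubling `x`-map on the same arc) with `[2]` replaced by
the `3`-isogeny; the `ℝ¹` plumbing (`hasFDerivAt_fin_one`, `det_smul_id_fin_one`,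
`const_apply_zero_eq`, `cube_add_one_pos_iff`) is reused from there. The other two arcs `(0, 2)`,
`(2, ∞)` of the cover are NOT treated here (neighbouring stubs).

References: M. Kontsevich, D. Zagier, *Periods* (2001), §1.2 rule (2); J. Vélu, *Isogénies entre
courbes elliptiques* (1971); J. H. Silverman, *The Arithmetic of Elliptic Curves* (2009), III.4.
-/

noncomputable section

open Set MeasureTheory MvPolynomial
open Literature.NumberTheory.Transcendental Literature.ModelTheory.ExponentialFields
open Summit.KontsevichZagierPeriods.HermiteRigidity.GenusTwoCycleTransfer
  (det_smul_id_fin_one hasFDerivAt_fin_one)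
open Summit.KontsevichZagierPeriods.IsogenyCertificates.LemniscateTwoIsogeny (const_apply_zero_eq)
open Summit.KontsevichZagierPeriods.IsogenyCertificates.XMapPeriodTransferValue (cube_add_one_pos_iff)

namespace Summit.KontsevichZagierPeriods.FermatIsogeny.BetaLinearSector.Sixths

/-! ### Real algebra of the `3`-isogeny `x`-map `X(x) = (x³ + 4)/(3x²)` on the arc `(−1, 0)` -/

/-- On `(−∞, 0)` the derivative `X′(x) = (x³ − 8)/(3x³)` of the `3`-isogeny `x`-map is positive
(numerator and denominator are negative). [folklore] -/
theorem isoNeg_deriv_pos {x : ℝ} (h2 : x < 0) : 0 < (x ^ 3 - 8) / (3 * x ^ 3) := by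
  have hx3 : x ^ 3 < 0 := Odd.pow_neg (by decide) h2
  exact div_pos_of_neg_of_neg (by linarith) (by linarith)

/-- `X > 1` on `(−1, 0)`: `x³ + 4 − 3x² = (x + 1)(x − 2)² > 0` and `3x² > 0` there. [folklore] -/
theorem isoNeg_one_lt {x : ℝ} (h1 : -1 < x) (h2 : x < 0) : 1 < (x ^ 3 + 4) / (3 * x ^ 2) := by
  rw [one_lt_div (mul_pos three_pos (sq_pos_of_neg h2))]
  nlinarith [mul_pos (by linarith : (0:ℝ) < x + 1) (sq_pos_of_neg (by linarith : x - 2 < 0))]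

/-- **The `3`-isogeny identity on the arc**: `X(x)³ − 1 = (√(x³ + 1)·X′(x))²/3` for `−1 < x < 0`,
i.e. `(x³ + 4)³ − 27x⁶ = (x³ + 1)(x³ − 8)²` (`Y(ψ P)² = X(ψ P)³ − 1` with `ψ^*(dX/Y) = √3·dx/y`).
[folklore] -/
theorem isoNeg_cube_sub_one {x : ℝ} (h1 : -1 < x) (h2 : x < 0) :
    ((x ^ 3 + 4) / (3 * x ^ 2)) ^ 3 - 1 =
      (Real.sqrt (x ^ 3 + 1) * ((x ^ 3 - 8) / (3 * x ^ 3))) ^ 2 / 3 := by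
  have h3 := (cube_add_one_pos_iff _).2 h1
  have hx : x ≠ 0 := h2.ne
  rw [mul_pow, Real.sq_sqrt h3.le, div_pow, div_pow]
  field_simp
  ring

/-- **The rule-2 integrand identity** `√3/√(x³ + 1) = (1/√(X(x)³ − 1))·|X′(x)|` on `(−1, 0)`.
[cite: KontsevichZagier2001, §1.2 rule (2)] -/
theorem isoNeg_jacobian {x : ℝ} (h1 : -1 < x) (h2 : x < 0) :
    Real.sqrt 3 / Real.sqrt (x ^ 3 + 1) =
      1 / Real.sqrt (((x ^ 3 + 4) / (3 * x ^ 2)) ^ 3 - 1) * |(x ^ 3 - 8) / (3 * x ^ 3)| := by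
  have h3 := (cube_add_one_pos_iff _).2 h1
  have hD : 0 < (x ^ 3 - 8) / (3 * x ^ 3) := isoNeg_deriv_pos h2
  rw [isoNeg_cube_sub_one h1 h2, abs_of_pos hD]
  set s := Real.sqrt (x ^ 3 + 1) with hs_def
  set D := (x ^ 3 - 8) / (3 * x ^ 3) with hD_def
  have hs : 0 < s := Real.sqrt_pos.mpr h3
  have hsD : 0 < s * D := mul_pos hs hD
  have hr3 : 0 < Real.sqrt 3 := Real.sqrt_pos.mpr three_pos
  rw [Real.sqrt_div' _ zero_le_three, Real.sqrt_sq hsD.le]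
  field_simp

/-- `X` is injective on `(−∞, 0)` (in particular on the arc `(−1, 0)`): `X a = X b` gives
`(a − b)·(a²b² − 4(a + b)) = 0`, and `a²b² − 4(a + b) > 0` for `a, b < 0`. [folklore] -/
theorem isoNeg_injective {a b : ℝ} (ha2 : a < 0) (hb2 : b < 0)
    (h : (a ^ 3 + 4) / (3 * a ^ 2) = (b ^ 3 + 4) / (3 * b ^ 2)) : a = b := by
  have hA : 0 < 3 * a ^ 2 := mul_pos three_pos (sq_pos_of_neg ha2)
  have hB : 0 < 3 * b ^ 2 := mul_pos three_pos (sq_pos_of_neg hb2)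
  rw [div_eq_div_iff hA.ne' hB.ne'] at h
  have key : (a - b) * (a ^ 2 * b ^ 2 - 4 * (a + b)) = 0 := by
    linear_combination (1 / 3 : ℝ) * h
  have hab : 0 < a * b := mul_pos_of_neg_of_neg ha2 hb2
  have hK : a ^ 2 * b ^ 2 - 4 * (a + b) ≠ 0 := by
    apply ne_of_gt
    nlinarith [mul_pos hab hab]
  rcases mul_eq_zero.mp key with h0 | h0
  · linarith
  · exact absurd h0 hK

/-- `X` has derivative `(x³ − 8)/(3x³)` at every `x < 0`. [folklore] -/
theorem isoNeg_hasDerivAt {x : ℝ} (h2 : x < 0) :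
    HasDerivAt (fun y : ℝ => (y ^ 3 + 4) / (3 * y ^ 2)) ((x ^ 3 - 8) / (3 * x ^ 3)) x := by
  have hx : x ≠ 0 := h2.ne
  have hnum : HasDerivAt (fun y : ℝ => y ^ 3 + 4) (3 * x ^ 2) x := by
    have h := (hasDerivAt_pow 3 x).add_const (4 : ℝ)
    exact h.congr_deriv (by norm_num)
  have hden : HasDerivAt (fun y : ℝ => 3 * y ^ 2) (3 * (2 * x)) x := by
    have h := (hasDerivAt_pow 2 x).const_mul (3 : ℝ)
    exact h.congr_deriv (by norm_num)
  have h3 : 3 * x ^ 2 ≠ 0 := mul_ne_zero three_ne_zero (pow_ne_zero 2 hx)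
  refine (hnum.fun_div hden h3).congr_deriv ?_
  rw [div_eq_div_iff (pow_ne_zero 2 h3) (mul_ne_zero three_ne_zero (pow_ne_zero 3 hx))]
  ring

/-- **Surjectivity**: every `c > 1` is `X x` for some `x ∈ (−1, 0)` (intermediate value theorem on
`[−1, −1/c]`: `X(−1) = 1 ≤ c ≤ X(−1/c)`, the latter being `(c − 1)(4c² + c + 1) ≥ 0`). [folklore] -/
theorem isoNeg_exists_eq {c : ℝ} (hc : 1 < c) :
    ∃ x : ℝ, -1 < x ∧ x < 0 ∧ (x ^ 3 + 4) / (3 * x ^ 2) = c := by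
  set F : ℝ → ℝ := fun y => (y ^ 3 + 4) / (3 * y ^ 2) with hF
  have hc0 : 0 < c := by linarith
  -- the right end point `b = −1/c`
  set b : ℝ := -c⁻¹ with hb
  have hci : 0 < c⁻¹ := inv_pos.mpr hc0
  have hci1 : c⁻¹ < 1 := inv_lt_one_of_one_lt₀ hc
  have hb1 : -1 < b := by linarith
  have hb2 : b < 0 := by linarith
  have hab : (-1 : ℝ) ≤ b := hb1.le
  have hFa : F (-1) = 1 := by norm_num [hF]
  have hFb : c ≤ F b := by
    show c ≤ (b ^ 3 + 4) / (3 * b ^ 2)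
    rw [le_div_iff₀ (mul_pos three_pos (sq_pos_of_neg hb2))]
    have hcb : c * b = -1 := by rw [hb, mul_neg, mul_inv_cancel₀ hc0.ne']
    have e : c * (3 * b ^ 2) = -3 * b := by
      calc c * (3 * b ^ 2) = 3 * (c * b) * b := by ring
        _ = -3 * b := by rw [hcb]; ring
    rw [e]
    nlinarith [mul_pos (by linarith : (0:ℝ) < b + 1) (by nlinarith : (0:ℝ) < b ^ 2 - b + 4)]
  -- intermediate value theorem on `[−1, b] ⊆ [−1, 0)`
  have hcont : ContinuousOn F (Icc (-1) b) := fun x hx =>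
    (isoNeg_hasDerivAt (by linarith [hx.2] : x < 0)).continuousAt.continuousWithinAt
  obtain ⟨x, hx, hxc⟩ := intermediate_value_Icc hab hcont ⟨by rw [hFa]; exact hc.le, hFb⟩
  refine ⟨x, ?_, by linarith [hx.2], hxc⟩
  rcases hx.1.lt_or_eq with h | h
  · exact h
  · exfalso
    rw [← h, hFa] at hxc
    linarith

/-! ### The `x`-map on `ℝ¹` -/

/-- `p ↦ X(p 0) = ((p 0)³ + 4)/(3(p 0)²)` is a `ℚ`-semialgebraic function on any `ℚ`-semialgebraic
set inside `{p 0 < 0}` (a quotient of `ℚ`-polynomials, pole-free there). [cite: BochnakCosteRoy1998, §2.2] -/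
theorem isoNeg_semialgebraic {σ : Set (Fin 1 → ℝ)} (hσ : IsSemialgebraic ℚ σ)
    (h0 : ∀ p ∈ σ, p 0 < 0) :
    IsSemialgebraicFunOn ℚ σ (fun p => ((p 0) ^ 3 + 4) / (3 * (p 0) ^ 2)) := by
  have h := isSemialgebraicFunOn_aeval_div_aeval hσ
    (X 0 ^ 3 + 4 : MvPolynomial (Fin 1) ℚ) (3 * X 0 ^ 2)
    (fun p hp => by
      simp only [map_mul, map_pow, aeval_X, map_ofNat]
      exact mul_ne_zero three_ne_zero (pow_ne_zero 2 (h0 p hp).ne))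
  refine h.congr fun p _ => ?_
  simp only [map_mul, map_add, map_pow, aeval_X, map_ofNat]

/-! ### One rule-2 move along `X` on the arc `(−1, 0)` -/

/-- **Rule 2 along the `3`-isogeny `x`-map, arc `(−1, 0)`.** For `S = [A, √3/√(x³+1)]` on the arc
`A = {−1 < p 0 < 0}` and `T = [{1 < p 0}, 1/√(x³−1)]` (integrands prescribed on the domains),
`[S] − [T] ∈ KZ.changeOfVariablesRel`, witnessed by `Φ : p ↦ (X(p 0))`, `Φ' p = X′(p 0) • id`
(`Φ` is `ℚ`-semialgebraic and injective on `A`, `Φ(A) = (1, ∞)`, `det Φ' = X′ > 0`, and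
`√3/√(x³+1) = (1/√(X³−1))·|X′|`). [cite: KontsevichZagier2001, §1.2 rule (2)] -/
theorem isoNeg_cov (S T : KZ.IntegralRep 1)
    (hSd : S.domain = {p : Fin 1 → ℝ | -1 < p 0 ∧ p 0 < 0})
    (hSi : ∀ p ∈ S.domain, S.integrand p = Real.sqrt 3 / Real.sqrt ((p 0) ^ 3 + 1))
    (hTd : T.domain = {p : Fin 1 → ℝ | 1 < p 0})
    (hTi : ∀ p ∈ T.domain, T.integrand p = 1 / Real.sqrt ((p 0) ^ 3 - 1)) :
    KZ.of S - KZ.of T ∈ KZ.changeOfVariablesRel := by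
  set Φ : (Fin 1 → ℝ) → (Fin 1 → ℝ) :=
    fun p _ => ((p 0) ^ 3 + 4) / (3 * (p 0) ^ 2) with hΦ_def
  set Φ' : (Fin 1 → ℝ) → ((Fin 1 → ℝ) →L[ℝ] (Fin 1 → ℝ)) := fun p =>
    (((p 0) ^ 3 - 8) / (3 * (p 0) ^ 3)) • ContinuousLinearMap.id ℝ (Fin 1 → ℝ) with hΦ'_def
  have hmem : ∀ p ∈ S.domain, -1 < p 0 ∧ p 0 < 0 := fun p hp => by rwa [hSd] at hp
  -- Φ is a semialgebraic map, with derivative Φ' within the arc, injective on the arc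
  have hΦsa : IsSemialgebraicMapOn ℚ S.domain Φ :=
    IsSemialgebraicMapOn.of_forall S.isSemialgebraic_domain fun _ =>
      isoNeg_semialgebraic S.isSemialgebraic_domain fun p hp => (hmem p hp).2
  have hderiv : ∀ p ∈ S.domain, HasFDerivWithinAt Φ (Φ' p) S.domain p := fun p hp =>
    (hasFDerivAt_fin_one (fun y : ℝ => (y ^ 3 + 4) / (3 * y ^ 2)) _ p
      (isoNeg_hasDerivAt (hmem p hp).2)).hasFDerivWithinAt
  have hinj : InjOn Φ S.domain := by
    intro p hp q hq h
    have h' : ((p 0) ^ 3 + 4) / (3 * (p 0) ^ 2) = ((q 0) ^ 3 + 4) / (3 * (q 0) ^ 2) :=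
      congrFun h 0
    have hpq : p 0 = q 0 := isoNeg_injective (hmem p hp).2 (hmem q hq).2 h'
    rw [← const_apply_zero_eq p, ← const_apply_zero_eq q, hpq]
  have hdet : ∀ p, (Φ' p).det = ((p 0) ^ 3 - 8) / (3 * (p 0) ^ 3) :=
    fun p => det_smul_id_fin_one _
  -- the image of the arc is `(1, ∞)`
  have himg : T.domain = Φ '' S.domain := by
    rw [hTd, hSd]
    ext q
    simp only [mem_image, mem_setOf_eq]
    constructor
    · intro hq
      obtain ⟨x, hx1, hx2, hx⟩ := isoNeg_exists_eq hq
      refine ⟨fun _ => x, ⟨hx1, hx2⟩, ?_⟩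
      rw [← const_apply_zero_eq q]
      funext i
      exact hx
    · rintro ⟨p, ⟨hp1, hp2⟩, rfl⟩
      exact isoNeg_one_lt hp1 hp2
  -- the Jacobian identity on the arc
  have hjac : ∀ p ∈ S.domain, S.integrand p = T.integrand (Φ p) * |(Φ' p).det| := by
    intro p hp
    have hΦp : Φ p ∈ T.domain := himg ▸ mem_image_of_mem Φ hp
    rw [hSi p hp, hTi _ hΦp, hdet p]
    exact isoNeg_jacobian (hmem p hp).1 (hmem p hp).2
  exact ⟨1, S, T, Φ, Φ', hΦsa, hderiv, hinj, himg, hjac, rfl⟩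

/-- **Stub `stub_isogenyThree_piece_neg`** (line `fermat-sector-transport` of `BetaLinearSector`,
level `6`): on the arc `(−1, 0)` of `y² = x³ + 1`, any representations `S = [(−1,0), √3/√(x³+1)]`,
`T = [(1,∞), 1/√(X³−1)]` (integrands prescribed on the domains only) are `KZ.Equivalent`, by ONE
change-of-variables move (Kontsevich–Zagier rule (2)) along the `x`-map `X = (x³+4)/(3x²)` of the
real `3`-isogeny `y² = x³ + 1 → Y² = X³ − 1`, which pulls `dX/Y` back to `√3·dx/y`.
[cite: KontsevichZagier2001, §1.2 rule (2)] -/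
theorem stub_isogenyThree_piece_neg : ∀ (S T : KZ.IntegralRep 1),
    S.domain = {x | -1 < x 0 ∧ x 0 < 0} →
    Set.EqOn S.integrand (fun x => Real.sqrt 3 / Real.sqrt (x 0 ^ 3 + 1)) S.domain →
    T.domain = {x | 1 < x 0} →
    Set.EqOn T.integrand (fun x => 1 / Real.sqrt (x 0 ^ 3 - 1)) T.domain → KZ.Equivalent S T := by
  intro S T hSd hSi hTd hTi
  exact KZ.changeOfVariablesRel_subset_relations
    (isoNeg_cov S T hSd (fun p hp => hSi hp) hTd (fun p hp => hTi hp))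

end Summit.KontsevichZagierPeriods.FermatIsogeny.BetaLinearSector.Sixths

end
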